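import Literature.Probability.RandomPlanarGeometry.SAWCountZdSymbolThirdCancellation
import Literature.Probability.RandomPlanarGeometry.SAWCountZdSymbolSecondCancellationUnconditional
import Literature.Probability.RandomPlanarGeometry.SAWCountZdSymbolThirdLowerCount
import Literature.Probability.RandomPlanarGeometry.SAWCountZdSymbolThirdMidCount
import Literature.Probability.RandomPlanarGeometry.SAWCountZdSymbolThirdTopCount
import HarnessLib

/-!
# THIRD CANCELLATION (unconditional): `[X^{2j−5}] B_j = 0` for every `j ≥ 5` — the third-layer law `[X^{2i−5}] R_i` for every `i ≥ 3` from the three censuses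

Topic `Literature/Probability/RandomPlanarGeometry` (the «SYMBOL POLYNOMIALITY» programme for `c_n(ℤ^d)`; closes the THIRD layer: on `SAWCountZdSymbolThirdCancellation.lean`
(a-p1 g26: the conditional core `coeff_symbolCorrPoly_two_mul_sub_five_eq_zero` under `SecondLayerSums i` and `ThirdLayerCoeff i`, `3 ≤ i ≤ j`),
`SAWCountZdSymbolSecondCancellationUnconditional.lean` (a-p1 g26: `secondLayerSums_of_le`), `SAWCountZdSymbolThirdCoefficient.lean` (a-p1 g26: the six-corner formula
`coeff_symbolPoly_two_mul_sub_five`), λ `SAWCountZdSymbolLeadingCoefficient.lean` (`topShapeSum_eq`), 6c/5b (`secondShapeSumTop_eq`, `three_mul_secondShapeSumBelow`) and the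
three third-layer censuses of a-p1 g27: `SAWCountZdSymbolThirdLowerCount.lean` (`thirdShapeSumLow_eq`, `thirdShapeSumLow_three`), `SAWCountZdSymbolThirdMidCount.lean`
(`three_mul_thirdShapeSumMid_add`), `SAWCountZdSymbolThirdTopCount.lean` (`thirdShapeSumTop_add`)).

PRINTED CONTEXT (locators only; nothing below is in print). Madras–Slade (1993) §1.1 eq. (1.1.8) p. 5 (the `1/d` expansion of `μ`), Definition 1.2.4, §1.2 p. 10;
Clisby–Liang–Slade (2007) §3.3 eqs. (29)/(31) (the `1/d` coefficients of `c_n`); Stanley EC1 §1.3 Prop. 1.3.7 eq. (1.28).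

THE THEOREM. `[X^{n−j}] P_n = 2^n S_j(n)`, `S_j = A_j − B_j`, `B_j = Σ_{i=2}^{j} R_i(X)·E_{j−i}(X−i)`. ★★★ `thirdLayerCoeff_of_le` — for EVERY `i ≥ 3`,
**`[X^{2i−5}] R_i = (8i⁴ − 13i³ − 8i² + 28i − 48)/(9·2^i·(i−2)!)`** (the THIRD-LAYER LAW of FINDING-ZD-SYMBOL-POLYNOMIALITY §16 (ii), now a theorem: the six-corner formula with
`S_i = (2i−3)(2i−5)‼2^{2i−2}`, `U'_i`, `V'_i` (second layer) and `T'_i`, `X'_i`, `W'_i` (third layer) in closed form; `i ≤ 6` by evaluation, `i ≥ 7` by one identity of rational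
functions in `i` after `(2i−5)‼ = (2i−5)(2i−7)(2i−9)(2i−11)(2i−13)‼` and `(2i−5)! = (2i−5)‼·2^{i−3}(i−3)!`). HENCE ★★★
`coeff_symbolCorrPoly_two_mul_sub_five_eq_zero'`: for every `j ≥ 5` **`[X^{2j−5}] B_j = 0`** — the THIRD of the `j − 3`
cancellations predicted by the STRUCTURE CONJECTURE «`deg P_j = j`» holds unconditionally; ★★★
`natDegree_symbolCorrPoly_le_sub_six'`: `deg B_j ≤ 2j − 6`; ★★★ `natDegree_coeffPoly_le_sub_six`: `deg S_j ≤ max(j, 2j−6)` — so `S_5` has degree `5` and `S_6` degree `6`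
(the monic faces `P₅`, `P₆` of the lane's (L1″)/(L1‴) are structural); ★★★ `exists_polynomial_countPoly_coeff_natDegree_le''`: for every `j ≥ 5` there is `S ∈ ℚ[X]` of degree
`≤ max(j, 2j−6)` with `[X^{n−j}] P_n = 2^n S(n)` for all `n ≥ 2j − 1`.

THIS FILE (lane «pcv-sawmu», a-p1 g27; all PROVED, standard axioms): `thirdLayerCoeff_small`, `p9q`, `pTq`, `pXq`, `pGq`, `df_chainQ`, `fact_chainQ`, `castSUV`, `castT`, `castX`,
`castW`, `third_identity`, `thirdLayerCoeff_large` (all private),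
★★★ `thirdLayerCoeff_of_le`, ★★★ `coeff_symbolCorrPoly_two_mul_sub_five_eq_zero'`, ★★★ `natDegree_symbolCorrPoly_le_sub_six'`, ★★★ `natDegree_coeffPoly_le_sub_six`,
★★★ `exists_polynomial_countPoly_coeff_natDegree_le''`.
[cite: MadrasSlade1993, §1.1 eq. (1.1.8) p. 5; Definition 1.2.4; §1.2 (p. 10)] [cite: ClisbyLiangSlade2007, §3.3 eqs. (29)/(31)] [cite: Stanley2012EC1, §1.3 Prop. 1.3.7 eq. (1.28)]

Provenance: lane «pcv-sawmu», a-p1 g27 (2026-08-28).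
-/

noncomputable section

open Finset
open scoped BigOperators
open Literature.Probability.LatticeModels
open Literature.Probability.RandomPlanarGeometry.SAW
open Literature.Probability.Percolation

namespace Literature.Probability.RandomPlanarGeometry.SAW.Zd

namespace WordTypes

/-! ### The six corner sums at `j = 3, …, 6` and the law there -/

/-- The third-layer law for `i = 3, 4, 5, 6` by evaluating the six corner sums (`29/8, 4, 121/64, 77/144`). [cite: MadrasSlade1993, Definition 1.2.4; lane lemma] -/
private theorem thirdLayerCoeff_small (i : ℕ) (hi : 3 ≤ i) (hi6 : i ≤ 6) : ThirdLayerCoeff i := by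
  unfold ThirdLayerCoeff
  obtain ⟨hT3, hT4, hT5, hT6, -, -⟩ := thirdShapeSumTop_values
  obtain ⟨hX3, hX4, hX5, hX6, -, -⟩ := thirdShapeSumMid_values
  obtain ⟨hW4, hW5, hW6, -, -⟩ := thirdShapeSumLow_seven
  have hW3 := thirdShapeSumLow_three
  have hS : ∀ j, 2 ≤ j → topShapeSum j = (2 * j - 3) * ((2 * j - 5).doubleFactorial * 2 ^ (2 * j - 2)) := topShapeSum_eq
  have hU : ∀ j, 3 ≤ j → secondShapeSumTop j = (2 * j - 4) * (4 * j - 7) * ((2 * j - 5).doubleFactorial * 2 ^ (2 * j - 3)) := secondShapeSumTop_eq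
  have hV : ∀ j, 3 ≤ j → 3 * secondShapeSumBelow j = (2 * j - 4) * (j + 3) * ((2 * j - 5).doubleFactorial * 2 ^ (2 * j - 3)) := three_mul_secondShapeSumBelow
  rcases (show i = 3 ∨ i = 4 ∨ i = 5 ∨ i = 6 by omega) with rfl | rfl | rfl | rfl
  · have h1 := hS 3 (by norm_num); have h2 := hU 3 le_rfl; have h3 := hV 3 le_rfl
    norm_num [Nat.doubleFactorial] at h1 h2 h3
    have h3' : secondShapeSumBelow 3 = 32 := by omega
    rw [coeff_symbolPoly_two_mul_sub_five 3 le_rfl, h1, h2, h3', hT3, hX3, hW3]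
    norm_num [Nat.factorial]
  · have h1 := hS 4 (by norm_num); have h2 := hU 4 (by norm_num); have h3 := hV 4 (by norm_num)
    norm_num [Nat.doubleFactorial] at h1 h2 h3
    have h3' : secondShapeSumBelow 4 = 896 := by omega
    rw [coeff_symbolPoly_two_mul_sub_five 4 (by norm_num), h1, h2, h3', hT4, hX4, hW4]
    norm_num [Nat.factorial]
  · have h1 := hS 5 (by norm_num); have h2 := hU 5 (by norm_num); have h3 := hV 5 (by norm_num)
    norm_num [Nat.doubleFactorial] at h1 h2 h3
    have h3' : secondShapeSumBelow 5 = 30720 := by omega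
    rw [coeff_symbolPoly_two_mul_sub_five 5 (by norm_num), h1, h2, h3', hT5, hX5, hW5]
    norm_num [Nat.factorial]
  · have h1 := hS 6 (by norm_num); have h2 := hU 6 (by norm_num); have h3 := hV 6 (by norm_num)
    norm_num [Nat.doubleFactorial] at h1 h2 h3
    have h3' : secondShapeSumBelow 6 = 1290240 := by omega
    rw [coeff_symbolPoly_two_mul_sub_five 6 (by norm_num), h1, h2, h3', hT6, hX6, hW6]
    norm_num [Nat.factorial]

/-! ### The law for `i ≥ 7`: one identity of rational functions -/

/-- `(2k+9)(2k+7)(2k+5)(2k+3)`: the ratio `(2i−5)‼/(2i−13)‼` at `i = k + 7`. [cite: Stanley2012EC1, §1.3 Prop. 1.3.7 eq. (1.28); lane plumbing] -/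
private def p9q (k : ℕ) : ℚ := (2 * (k : ℚ) + 9) * (2 * k + 7) * (2 * k + 5) * (2 * k + 3)

/-- `T'_{k+7}/((2k+1)‼·2^{2k+10})` as a polynomial in `k` (from `thirdShapeSumTop_add`). [cite: MadrasSlade1993, Definition 1.2.4; lane plumbing] -/
private def pTq (k : ℕ) : ℚ :=
  (2 * (k : ℚ) + 9) * (12 * p9q k + 8 * ((2 * (k : ℚ) + 7) * (2 * k + 5) * (2 * k + 3))) + (2 * (k : ℚ) + 9) * (2 * k + 8) * (12 * p9q k)
    + (2 * (k : ℚ) + 9) * (k + 4) * (2 * k + 7) * (4 * p9q k + (2 * (k : ℚ) + 5) * (2 * k + 3))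
    - ((2 * (k : ℚ) + 9) * (4 * k + 17) + (2 * (k : ℚ) + 9) * (k + 4) * (2 * k + 7)) * (4 * ((2 * (k : ℚ) + 7) * (2 * k + 5) * (2 * k + 3)))

/-- `3·X'_{k+7}/((2k+1)‼·2^{2k+10})` as a rational function of `k` (from `three_mul_thirdShapeSumMid_add`). [cite: MadrasSlade1993, Definition 1.2.4; lane plumbing] -/
private def pXq (k : ℕ) : ℚ :=
  2 * (2 * (k : ℚ) + 9) * (2 * k + 10) * (k + 10) * p9q k
    - (2 * (k : ℚ) + 9) * (9 * ((2 * (k : ℚ) + 7) * (2 * k + 5) * (2 * k + 3))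
      + 3 * (2 * (k : ℚ) + 8) * ((2 * (k : ℚ) + 7) * (2 * k + 6) * (2 * k + 5) / 6 * (2 * (k : ℚ) + 3) + 3 * (2 * (k : ℚ) + 7) * ((2 * (k : ℚ) + 5) * (2 * k + 3))))

/-- `W'_{k+7}/((2k+9)·(2k+1)‼·2^{2k+10})` as a rational function of `k` (from `thirdShapeSumLow_eq`). [cite: MadrasSlade1993, Definition 1.2.4; lane plumbing] -/
private def pGq (k : ℕ) : ℚ :=
  2 * (2 * (k : ℚ) + 8) * (2 * k + 7) * ((2 * (k : ℚ) + 5) * (2 * k + 3)) + 2 * (2 * (k : ℚ) + 8) * ((2 * (k : ℚ) + 7) * (2 * k + 6) * (2 * k + 5) / 6 * (2 * (k : ℚ) + 3))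
    + ((2 * (k : ℚ) + 8) * (2 * k + 7) * (2 * k + 6) * (2 * k + 5) / 24 * (2 * (k : ℚ) + 3)
      + 10 * ((2 * (k : ℚ) + 8) * (2 * k + 7) * (2 * k + 6) * (2 * k + 5) * (2 * k + 4) * (2 * k + 3) / 720))

/-- The double-factorial chain at `i = k + 7` in `ℚ`: `(2k+3)‼, …, (2k+9)‼` over `d = (2k+1)‼`. [cite: Stanley2012EC1, §1.3 Prop. 1.3.7 eq. (1.28); lane plumbing] -/
private theorem df_chainQ (k : ℕ) :
    ((2 * k + 3).doubleFactorial : ℚ) = (2 * k + 3) * ((2 * k + 1).doubleFactorial : ℚ) ∧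
    ((2 * k + 5).doubleFactorial : ℚ) = (2 * k + 5) * (2 * k + 3) * ((2 * k + 1).doubleFactorial : ℚ) ∧
    ((2 * k + 7).doubleFactorial : ℚ) = (2 * k + 7) * (2 * k + 5) * (2 * k + 3) * ((2 * k + 1).doubleFactorial : ℚ) ∧
    ((2 * k + 9).doubleFactorial : ℚ) = p9q k * ((2 * k + 1).doubleFactorial : ℚ) := by
  have d3 : (2 * k + 3).doubleFactorial = (2 * k + 3) * (2 * k + 1).doubleFactorial := Nat.doubleFactorial_add_two (2 * k + 1)
  have d5 : (2 * k + 5).doubleFactorial = (2 * k + 5) * (2 * k + 3).doubleFactorial := Nat.doubleFactorial_add_two (2 * k + 3)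
  have d7 : (2 * k + 7).doubleFactorial = (2 * k + 7) * (2 * k + 5).doubleFactorial := Nat.doubleFactorial_add_two (2 * k + 5)
  have d9 : (2 * k + 9).doubleFactorial = (2 * k + 9) * (2 * k + 7).doubleFactorial := Nat.doubleFactorial_add_two (2 * k + 7)
  have q3 : ((2 * k + 3).doubleFactorial : ℚ) = (2 * k + 3) * ((2 * k + 1).doubleFactorial : ℚ) := by exact_mod_cast d3
  have q5 : ((2 * k + 5).doubleFactorial : ℚ) = (2 * k + 5) * ((2 * k + 3).doubleFactorial : ℚ) := by exact_mod_cast d5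
  have q7 : ((2 * k + 7).doubleFactorial : ℚ) = (2 * k + 7) * ((2 * k + 5).doubleFactorial : ℚ) := by exact_mod_cast d7
  have q9 : ((2 * k + 9).doubleFactorial : ℚ) = (2 * k + 9) * ((2 * k + 7).doubleFactorial : ℚ) := by exact_mod_cast d9
  refine ⟨q3, by rw [q5, q3]; ring, by rw [q7, q5, q3]; ring, by rw [q9, q7, q5, q3, p9q]; ring⟩

/-- The factorials at `i = k + 7` in `ℚ` over `(2k+1)‼`, `2^{k+4}` and `(k+4)!`. [cite: Stanley2012EC1, §1.3 Prop. 1.3.7 eq. (1.28); lane plumbing] -/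
private theorem fact_chainQ (k : ℕ) :
    ((2 * k + 9).factorial : ℚ) = p9q k * ((2 * k + 1).doubleFactorial : ℚ) * ((2 : ℚ) ^ (k + 4) * ((k + 4).factorial : ℚ)) ∧
    ((2 * k + 10).factorial : ℚ) = (2 * k + 10) * (p9q k * ((2 * k + 1).doubleFactorial : ℚ) * ((2 : ℚ) ^ (k + 4) * ((k + 4).factorial : ℚ))) ∧
    ((2 * k + 11).factorial : ℚ) = (2 * k + 11) * (2 * k + 10) * (p9q k * ((2 * k + 1).doubleFactorial : ℚ) * ((2 : ℚ) ^ (k + 4) * ((k + 4).factorial : ℚ))) ∧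
    ((k + 5).factorial : ℚ) = (k + 5) * ((k + 4).factorial : ℚ) := by
  have f9 : (2 * k + 9).factorial = (2 * k + 9).doubleFactorial * (2 * k + 8).doubleFactorial := Nat.factorial_eq_mul_doubleFactorial (2 * k + 8)
  have f8 : (2 * k + 8).doubleFactorial = 2 ^ (k + 4) * (k + 4).factorial := by
    rw [show 2 * k + 8 = 2 * (k + 4) by ring]; exact Nat.doubleFactorial_two_mul (k + 4)
  have q9 : ((2 * k + 9).factorial : ℚ) = p9q k * ((2 * k + 1).doubleFactorial : ℚ) * ((2 : ℚ) ^ (k + 4) * ((k + 4).factorial : ℚ)) := by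
    rw [← (df_chainQ k).2.2.2]; rw [f9, f8]; push_cast; ring
  refine ⟨q9, ?_, ?_, by exact_mod_cast Nat.factorial_succ (k + 4)⟩
  · rw [← q9]; exact_mod_cast Nat.factorial_succ (2 * k + 9)
  · rw [← q9]; have := Nat.factorial_succ (2 * k + 10); rw [Nat.factorial_succ (2 * k + 9)] at this; exact_mod_cast (by rw [this]; ring)

/-- The three lower-layer sums at `i = k + 7` in `ℚ`. [cite: MadrasSlade1993, Definition 1.2.4; lane plumbing] -/
private theorem castSUV (k : ℕ) :
    (topShapeSum (k + 7) : ℚ) = (2 * k + 11) * (p9q k * ((2 * k + 1).doubleFactorial : ℚ) * (4 * (2 : ℚ) ^ (2 * k + 10))) ∧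
    (secondShapeSumTop (k + 7) : ℚ) = (2 * k + 10) * (4 * k + 21) * (p9q k * ((2 * k + 1).doubleFactorial : ℚ) * (2 * (2 : ℚ) ^ (2 * k + 10))) ∧
    (secondShapeSumBelow (k + 7) : ℚ) = (2 * k + 10) * (k + 10) * (p9q k * ((2 * k + 1).doubleFactorial : ℚ) * (2 * (2 : ℚ) ^ (2 * k + 10))) / 3 := by
  have hS := topShapeSum_eq (k + 7) (by omega)
  have hU := secondShapeSumTop_eq (k + 7) (by omega)
  have hV := three_mul_secondShapeSumBelow (k + 7) (by omega)
  have e3 : 2 * (k + 7) - 3 = 2 * k + 11 := by omega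
  have e4 : 2 * (k + 7) - 4 = 2 * k + 10 := by omega
  have e5 : 2 * (k + 7) - 5 = 2 * k + 9 := by omega
  have e2 : 2 * (k + 7) - 2 = 2 * k + 12 := by omega
  have e47 : 4 * (k + 7) - 7 = 4 * k + 21 := by omega
  rw [e3, e5, e2] at hS
  rw [e4, e47, e5, e3] at hU
  rw [e4, e5, e3] at hV
  have q9 := (df_chainQ k).2.2.2
  have p11 : (2 : ℚ) ^ (2 * k + 11) = 2 * 2 ^ (2 * k + 10) := by rw [pow_succ, mul_comm]
  have p12 : (2 : ℚ) ^ (2 * k + 12) = 4 * 2 ^ (2 * k + 10) := by rw [show 2 * k + 12 = (2 * k + 10) + 2 by ring, pow_add]; ring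
  refine ⟨?_, ?_, ?_⟩
  · have := congrArg (Nat.cast : ℕ → ℚ) hS; push_cast at this; rw [this, q9, p12]
  · have := congrArg (Nat.cast : ℕ → ℚ) hU; push_cast at this; rw [this, q9, p11]
  · have h3 := congrArg (Nat.cast : ℕ → ℚ) hV; push_cast at h3; rw [q9, p11] at h3
    rw [eq_div_iff (by norm_num)]; linear_combination h3

/-- `T'_{k+7}` in `ℚ`. [cite: MadrasSlade1993, Definition 1.2.4; lane plumbing] -/
private theorem castT (k : ℕ) : (thirdShapeSumTop (k + 7) : ℚ) = ((2 * k + 1).doubleFactorial : ℚ) * (2 : ℚ) ^ (2 * k + 10) * pTq k := by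
  have hT := thirdShapeSumTop_add (k + 7) (by omega)
  have e3 : 2 * (k + 7) - 3 = 2 * k + 11 := by omega
  have e4 : 2 * (k + 7) - 4 = 2 * k + 10 := by omega
  have e5 : 2 * (k + 7) - 5 = 2 * k + 9 := by omega
  have e6 : 2 * (k + 7) - 6 = 2 * k + 8 := by omega
  have e7 : 2 * (k + 7) - 7 = 2 * k + 7 := by omega
  have e9 : 2 * (k + 7) - 9 = 2 * k + 5 := by omega
  have e2 : 2 * (k + 7) - 2 = 2 * k + 12 := by omega
  have e1 : 2 * (k + 7) - 1 = 2 * k + 13 := by omega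
  have ej3 : k + 7 - 3 = k + 4 := by omega
  rw [e5, e6, ej3, e7, e3, e2, e1, e9, e4] at hT
  obtain ⟨-, q5, q7, q9⟩ := df_chainQ k
  have p11 : (2 : ℚ) ^ (2 * k + 11) = 2 * 2 ^ (2 * k + 10) := by rw [pow_succ, mul_comm]
  have p12 : (2 : ℚ) ^ (2 * k + 12) = 4 * 2 ^ (2 * k + 10) := by rw [show 2 * k + 12 = (2 * k + 10) + 2 by ring, pow_add]; ring
  have p13 : (2 : ℚ) ^ (2 * k + 13) = 8 * 2 ^ (2 * k + 10) := by rw [show 2 * k + 13 = (2 * k + 10) + 3 by ring, pow_add]; ring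
  have := congrArg (Nat.cast : ℕ → ℚ) hT; push_cast at this
  rw [q9, q7, q5, p11, p12, p13] at this
  rw [pTq]
  linear_combination this

/-- `X'_{k+7}` in `ℚ`. [cite: MadrasSlade1993, Definition 1.2.4; lane plumbing] -/
private theorem castX (k : ℕ) : (thirdShapeSumMid (k + 7) : ℚ) = ((2 * k + 1).doubleFactorial : ℚ) * (2 : ℚ) ^ (2 * k + 10) * pXq k / 3 := by
  have hX := three_mul_thirdShapeSumMid_add (k + 7) (by omega)
  unfold thirdMidK at hX
  have e3 : 2 * (k + 7) - 3 = 2 * k + 11 := by omega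
  have e4 : 2 * (k + 7) - 4 = 2 * k + 10 := by omega
  have e5 : 2 * (k + 7) - 5 = 2 * k + 9 := by omega
  have e6 : 2 * (k + 7) - 6 = 2 * k + 8 := by omega
  have e7 : 2 * (k + 7) - 7 = 2 * k + 7 := by omega
  have e9 : 2 * (k + 7) - 9 = 2 * k + 5 := by omega
  have e11 : 2 * (k + 7) - 11 = 2 * k + 3 := by omega
  rw [e5, e7, e6, e11, e9, e4, e3] at hX
  obtain ⟨q3, q5, q7, q9⟩ := df_chainQ k
  have b73 : (2 * k + 7).choose 3 * 6 = (2 * k + 7) * (2 * k + 6) * (2 * k + 5) := by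
    have h := Nat.descFactorial_eq_factorial_mul_choose (2 * k + 7) 3
    rw [show (3 : ℕ).factorial = 6 by decide] at h
    rw [mul_comm, ← h]
    simp only [Nat.descFactorial_succ, Nat.descFactorial_zero, mul_one]
    rw [show 2 * k + 7 - 0 = 2 * k + 7 by omega, show 2 * k + 7 - 1 = 2 * k + 6 by omega, show 2 * k + 7 - 2 = 2 * k + 5 by omega]
    ring
  have qb73 : (((2 * k + 7).choose 3 : ℕ) : ℚ) = (2 * k + 7) * (2 * k + 6) * (2 * k + 5) / 6 := by
    rw [eq_div_iff (by norm_num)]; exact_mod_cast b73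
  have p11 : (2 : ℚ) ^ (2 * k + 11) = 2 * 2 ^ (2 * k + 10) := by rw [pow_succ, mul_comm]
  have := congrArg (Nat.cast : ℕ → ℚ) hX; push_cast at this
  rw [q9, q7, q5, q3, qb73, p11] at this
  rw [eq_div_iff (by norm_num), pXq]
  linear_combination this

/-- `W'_{k+7}` in `ℚ`. [cite: MadrasSlade1993, Definition 1.2.4; lane plumbing] -/
private theorem castW (k : ℕ) :
    (thirdShapeSumLow (k + 7) : ℚ) = (2 * k + 9) * (((2 * k + 1).doubleFactorial : ℚ) * pGq k * (2 : ℚ) ^ (2 * k + 10)) := by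
  have hW := thirdShapeSumLow_eq (k + 7) (by omega)
  unfold thirdLowerG at hW
  have e4 : 2 * (k + 7) - 4 = 2 * k + 10 := by omega
  have e5 : 2 * (k + 7) - 5 = 2 * k + 9 := by omega
  have e6 : 2 * (k + 7) - 6 = 2 * k + 8 := by omega
  have e7 : 2 * (k + 7) - 7 = 2 * k + 7 := by omega
  have e9 : 2 * (k + 7) - 9 = 2 * k + 5 := by omega
  have e11 : 2 * (k + 7) - 11 = 2 * k + 3 := by omega
  have e13 : 2 * (k + 7) - 13 = 2 * k + 1 := by omega
  rw [e5, e6, e7, e9, e11, e13, e4] at hW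
  obtain ⟨q3, q5, -, -⟩ := df_chainQ k
  have b73 : (2 * k + 7).choose 3 * 6 = (2 * k + 7) * (2 * k + 6) * (2 * k + 5) := by
    have h := Nat.descFactorial_eq_factorial_mul_choose (2 * k + 7) 3
    rw [show (3 : ℕ).factorial = 6 by decide] at h
    rw [mul_comm, ← h]
    simp only [Nat.descFactorial_succ, Nat.descFactorial_zero, mul_one]
    rw [show 2 * k + 7 - 0 = 2 * k + 7 by omega, show 2 * k + 7 - 1 = 2 * k + 6 by omega, show 2 * k + 7 - 2 = 2 * k + 5 by omega]
    ring
  have b84 : (2 * k + 8).choose 4 * 24 = (2 * k + 8) * (2 * k + 7) * (2 * k + 6) * (2 * k + 5) := by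
    have h := Nat.descFactorial_eq_factorial_mul_choose (2 * k + 8) 4
    rw [show (4 : ℕ).factorial = 24 by decide] at h
    rw [mul_comm, ← h]
    simp only [Nat.descFactorial_succ, Nat.descFactorial_zero, mul_one]
    rw [show 2 * k + 8 - 0 = 2 * k + 8 by omega, show 2 * k + 8 - 1 = 2 * k + 7 by omega, show 2 * k + 8 - 2 = 2 * k + 6 by omega,
      show 2 * k + 8 - 3 = 2 * k + 5 by omega]
    ring
  have b86 : (2 * k + 8).choose 6 * 720 = (2 * k + 8) * (2 * k + 7) * (2 * k + 6) * (2 * k + 5) * (2 * k + 4) * (2 * k + 3) := by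
    have h := Nat.descFactorial_eq_factorial_mul_choose (2 * k + 8) 6
    rw [show (6 : ℕ).factorial = 720 by decide] at h
    rw [mul_comm, ← h]
    simp only [Nat.descFactorial_succ, Nat.descFactorial_zero, mul_one]
    rw [show 2 * k + 8 - 0 = 2 * k + 8 by omega, show 2 * k + 8 - 1 = 2 * k + 7 by omega, show 2 * k + 8 - 2 = 2 * k + 6 by omega,
      show 2 * k + 8 - 3 = 2 * k + 5 by omega, show 2 * k + 8 - 4 = 2 * k + 4 by omega, show 2 * k + 8 - 5 = 2 * k + 3 by omega]
    ring
  have qb73 : (((2 * k + 7).choose 3 : ℕ) : ℚ) = (2 * k + 7) * (2 * k + 6) * (2 * k + 5) / 6 := by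
    rw [eq_div_iff (by norm_num)]; exact_mod_cast b73
  have qb84 : (((2 * k + 8).choose 4 : ℕ) : ℚ) = (2 * k + 8) * (2 * k + 7) * (2 * k + 6) * (2 * k + 5) / 24 := by
    rw [eq_div_iff (by norm_num)]; exact_mod_cast b84
  have qb86 : (((2 * k + 8).choose 6 : ℕ) : ℚ) = (2 * k + 8) * (2 * k + 7) * (2 * k + 6) * (2 * k + 5) * (2 * k + 4) * (2 * k + 3) / 720 := by
    rw [eq_div_iff (by norm_num)]; exact_mod_cast b86
  have := congrArg (Nat.cast : ℕ → ℚ) hW; push_cast at this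
  rw [q5, q3, qb73, qb84, qb86] at this
  rw [this, pGq]
  ring

/-- The identity behind the law at `i = k + 7`: the six-corner formula with the six closed forms substituted, as an identity of rational functions of `k` and of
four nonzero scalars `d = (2k+1)‼`, `E = 2^{2k+10}`, `G = 2^{k+4}`, `F = (k+4)!` (which cancel). [cite: MadrasSlade1993, Definition 1.2.4; lane plumbing] -/
private theorem third_identity (k : ℕ) (d E G F : ℚ) (hd : d ≠ 0) (hE : E ≠ 0) (hG : G ≠ 0) (hF : F ≠ 0) :
    (2 * (k : ℚ) + 11) * (p9q k * d * (4 * E)) * (1 / (16 * E)) / ((2 * (k : ℚ) + 11) * (2 * (k : ℚ) + 10) * (p9q k * d * (G * F))) *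
          ((2 * ((k + 7 : ℕ) : ℚ) - 3) * (2 * ((k + 7 : ℕ) : ℚ) - 4) / 2 * ((1 - 2 * ((k + 7 : ℕ) : ℚ)) ^ 2 - (2 * ((k + 7 : ℕ) : ℚ) - 4) * (1 - 2 * ((k + 7 : ℕ) : ℚ)))
            + (2 * ((k + 7 : ℕ) : ℚ) - 3) * (2 * ((k + 7 : ℕ) : ℚ) - 4) * (2 * ((k + 7 : ℕ) : ℚ) - 5) * (3 * (2 * ((k + 7 : ℕ) : ℚ) - 5) + 5) / 24)
        + (2 * (k : ℚ) + 10) * (4 * (k : ℚ) + 21) * (p9q k * d * (2 * E)) * (1 / (16 * E)) / ((2 * (k : ℚ) + 10) * (p9q k * d * (G * F))) *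
          ((2 * ((k + 7 : ℕ) : ℚ) - 4) * (1 - ((2 * (k + 7) : ℕ) : ℚ)) - (2 * ((k + 7 : ℕ) : ℚ) - 4) * (2 * ((k + 7 : ℕ) : ℚ) - 5) / 2)
        + (2 * (k : ℚ) + 10) * ((k : ℚ) + 10) * (p9q k * d * (2 * E)) / 3 * (1 / (8 * E)) / ((2 * (k : ℚ) + 10) * (p9q k * d * (G * F))) *
          ((2 * ((k + 7 : ℕ) : ℚ) - 4) * (1 - ((2 * k + 13 : ℕ) : ℚ)) - (2 * ((k + 7 : ℕ) : ℚ) - 4) * (2 * ((k + 7 : ℕ) : ℚ) - 5) / 2)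
        + d * E * pTq k * (1 / (16 * E)) / (p9q k * d * (G * F))
        + d * E * pXq k / 3 * (1 / (8 * E)) / (p9q k * d * (G * F))
        + (2 * (k : ℚ) + 9) * (d * pGq k * E) * (1 / (4 * E)) / (p9q k * d * (G * F)) =
      (8 * ((k + 7 : ℕ) : ℚ) ^ 4 - 13 * ((k + 7 : ℕ) : ℚ) ^ 3 - 8 * ((k + 7 : ℕ) : ℚ) ^ 2 + 28 * ((k + 7 : ℕ) : ℚ) - 48) /
        (9 * (8 * G) * (((k : ℚ) + 5) * F)) := by
  have h9 : p9q k ≠ 0 := by unfold p9q; positivity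
  have h10 : (2 * (k : ℚ) + 10) ≠ 0 := by positivity
  have h11 : (2 * (k : ℚ) + 11) ≠ 0 := by positivity
  have h5 : ((k : ℚ) + 5) ≠ 0 := by positivity
  push_cast
  field_simp
  unfold pTq pXq pGq p9q
  field_simp
  ring

/-- The third-layer law for `i ≥ 7` (all double factorials positive): substitute the six closed forms into the six-corner formula; it becomes `third_identity`.
[cite: MadrasSlade1993, Definition 1.2.4; lane lemma] -/
private theorem thirdLayerCoeff_large (i : ℕ) (hi : 7 ≤ i) : ThirdLayerCoeff i := by
  unfold ThirdLayerCoeff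
  obtain ⟨k, rfl⟩ : ∃ k, i = k + 7 := ⟨i - 7, by omega⟩
  have e3 : 2 * (k + 7) - 3 = 2 * k + 11 := by omega
  have e4 : 2 * (k + 7) - 4 = 2 * k + 10 := by omega
  have e5 : 2 * (k + 7) - 5 = 2 * k + 9 := by omega
  have e2 : 2 * (k + 7) - 2 = 2 * k + 12 := by omega
  have e1 : 2 * (k + 7) - 1 = 2 * k + 13 := by omega
  have ej2 : k + 7 - 2 = k + 5 := by omega
  rw [coeff_symbolPoly_two_mul_sub_five (k + 7) (by omega), e3, e4, e5, e1, e2, ej2]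
  obtain ⟨rS, rU, rV⟩ := castSUV k
  obtain ⟨f9, f10, f11, fk⟩ := fact_chainQ k
  rw [rS, rU, rV, castT k, castX k, castW k, f11, f10, f9, fk]
  -- powers of two over `E = 2^{2k+10}` and `G = 2^{k+4}`
  have ph14 : ((1 : ℚ) / 2) ^ (2 * (k + 7)) = 1 / (16 * (2 : ℚ) ^ (2 * k + 10)) := by
    rw [one_div_pow, show 2 * (k + 7) = (2 * k + 10) + 4 by ring, pow_add]; ring
  have ph13 : ((1 : ℚ) / 2) ^ (2 * k + 13) = 1 / (8 * (2 : ℚ) ^ (2 * k + 10)) := by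
    rw [one_div_pow, show 2 * k + 13 = (2 * k + 10) + 3 by ring, pow_add]; ring
  have ph12 : ((1 : ℚ) / 2) ^ (2 * k + 12) = 1 / (4 * (2 : ℚ) ^ (2 * k + 10)) := by
    rw [one_div_pow, show 2 * k + 12 = (2 * k + 10) + 2 by ring, pow_add]; ring
  have p7 : (2 : ℚ) ^ (k + 7) = 8 * 2 ^ (k + 4) := by rw [show k + 7 = (k + 4) + 3 by ring, pow_add]; ring
  rw [ph14, ph13, ph12, p7]
  exact third_identity k _ _ _ _ (by exact_mod_cast (Nat.doubleFactorial_pos _).ne') (pow_ne_zero _ two_ne_zero) (pow_ne_zero _ two_ne_zero)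
    (by exact_mod_cast (k + 4).factorial_ne_zero)

/-! ### ★★★ The third-layer law and the third cancellation, unconditionally -/

/-- ★★★ THE THIRD-LAYER LAW FOR EVERY `i ≥ 3`: `[X^{2i−5}] R_i = (8i⁴ − 13i³ − 8i² + 28i − 48)/(9·2^i·(i−2)!)` — FINDING-ZD-SYMBOL-POLYNOMIALITY §16 (ii) as a theorem
(the six-corner formula of `SAWCountZdSymbolThirdCoefficient` with all six corner censuses in closed form). [cite: MadrasSlade1993, §1.1 eq. (1.1.8) p. 5; Definition 1.2.4]
[cite: ClisbyLiangSlade2007, §3.3 eqs. (29)/(31); lane theorem] -/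
theorem thirdLayerCoeff_of_le (i : ℕ) (hi : 3 ≤ i) : ThirdLayerCoeff i := by
  rcases Nat.lt_or_ge i 7 with h | h
  · exact thirdLayerCoeff_small i hi (by omega)
  · exact thirdLayerCoeff_large i h

/-- ★★★ THIRD CANCELLATION (unconditional): for every `j ≥ 5` the `X^{2j−5}`-coefficient of the bad-word correction `B_j = Σ_{i=2}^{j} R_i(X) E_{j−i}(X−i)` to the `j`-th
`1/d`-symbol of `c_n(ℤ^d)` VANISHES. [cite: MadrasSlade1993, §1.1 eq. (1.1.8) p. 5; Definition 1.2.4] [cite: ClisbyLiangSlade2007, §3.3 eqs. (29)/(31); lane theorem] -/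
theorem coeff_symbolCorrPoly_two_mul_sub_five_eq_zero' (j : ℕ) (hj : 5 ≤ j) : (symbolCorrPoly j).coeff (2 * j - 5) = 0 :=
  coeff_symbolCorrPoly_two_mul_sub_five_eq_zero j hj (fun i hi _ => secondLayerSums_of_le i hi) (fun i hi _ => thirdLayerCoeff_of_le i hi)

/-- ★★★ Hence `deg B_j ≤ 2j − 6` for every `j ≥ 5`. [cite: MadrasSlade1993, §1.1 eq. (1.1.8) p. 5; Definition 1.2.4]
[cite: ClisbyLiangSlade2007, §3.3 eqs. (29)/(31); lane theorem] -/
theorem natDegree_symbolCorrPoly_le_sub_six' (j : ℕ) (hj : 5 ≤ j) : (symbolCorrPoly j).natDegree ≤ 2 * j - 6 :=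
  natDegree_symbolCorrPoly_le_sub_six j hj (fun i hi _ => secondLayerSums_of_le i hi) (fun i hi _ => thirdLayerCoeff_of_le i hi)

/-- ★★★ And `deg S_j ≤ max(j, 2j − 6)` for every `j ≥ 5` (sharp for `j ≤ 6`: the monic faces of `P₅`, `P₆` are structural). [cite: MadrasSlade1993, §1.1 eq. (1.1.8) p. 5;
Definition 1.2.4] [cite: ClisbyLiangSlade2007, §3.3 eqs. (29)/(31); lane theorem] -/
theorem natDegree_coeffPoly_le_sub_six (j : ℕ) (hj : 5 ≤ j) : (coeffPoly j).natDegree ≤ max j (2 * j - 6) :=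
  natDegree_coeffPoly_le_of_thirdLayer j hj (fun i hi _ => secondLayerSums_of_le i hi) (fun i hi _ => thirdLayerCoeff_of_le i hi)

/-- ★★★ COEFFICIENT POLYNOMIALITY WITH THREE CANCELLATIONS: for every `j ≥ 5` there is `S ∈ ℚ[X]` of degree `≤ max(j, 2j − 6)` with `[X^{n−j}] P_n = 2^n S(n)` for all
`n ≥ 2j − 1`. [cite: MadrasSlade1993, §1.1 eq. (1.1.8) p. 5; §1.2 p. 10] [cite: ClisbyLiangSlade2007, §3.3 eqs. (29)/(31); lane theorem] -/
theorem exists_polynomial_countPoly_coeff_natDegree_le'' (j : ℕ) (hj : 5 ≤ j) :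
    ∃ S : Polynomial ℚ, S.natDegree ≤ max j (2 * j - 6) ∧ ∀ n : ℕ, 2 * j ≤ n + 1 → (countPoly n).coeff (n - j) = 2 ^ n * S.eval (n : ℚ) :=
  ⟨coeffPoly j, natDegree_coeffPoly_le_sub_six j hj, fun n hn => countPoly_coeff_eq_pow_mul_eval_coeffPoly j (by omega) n hn⟩

end WordTypes

end Literature.Probability.RandomPlanarGeometry.SAW.Zd
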